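import Mathlib
import Literature.NumberTheory.LFunctions.Zhang2022.SkeletonObjects
import HarnessLib

/-!
# Zhang (2022) §15 p. 80 (`Z22:§15.u011`) and §17 p. 96: the orthogonality of the primitive
# characters to a prime modulus `p ∼ P`, kernel-checked

Topic `Literature/NumberTheory/LFunctions/Zhang2022` (Landau–Siegel audit tree; verdict-neutral).
Y. Zhang, *Discrete mean estimates and the Landau–Siegel zero*, arXiv:2211.02515v1 (2022)
[Zhang2022LandauSiegel] — **an unrefereed manuscript under adjudication** (cell siegel-zhang, D-0069;
DAG node ids `Z22:…` of `plan/DAG.tsv`). Companion of `Zhang2022/SmoothWeightMellin.lean`: after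
"integrating term by term", every evaluation of §§14–17 (and §7 p. 36, `Z22:§7.u025`) extracts the
diagonal from the character sum over the family `Ψ` restricted to one modulus,
`Σ*_{ψ (mod p)}` = the sum over the PRIMITIVE characters `ψ (mod p)` (§2 p. 4):

* `Z22:§15.u011` [Z22 p. 80, tex L4045]: "`Σ*_{ψ (mod p)} ψ(n)ψ̄(Dm) ≪ p` if `n = Dm`, `≪ 1` if
  `n ≠ Dm`" (for `n < PT⁻⁵`, `Dm < 2n`); the same sum `Σ*_{ψ mod p} ψ(m)ψ̄(n)` at §17 p. 96,
  tex L4723–4727, whose diagonal gives (17.3).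

PROVED here (UNCONDITIONAL, no (A), no named fact): to a PRIME modulus the primitive characters are
exactly the non-principal ones (`PrimChar.isPrimitive_iff_ne_one`), and
`Σ_{ψ ≠ 1} ψ(m)ψ⁻¹(n) = (p − 1)·[m ≡ n ≢ 0 (mod p)] − [p ∤ m][p ∤ n]` EXACTLY
(`PrimChar.sum_ne_one_apply_mul_inv_apply`; Mathlib's `DirichletCharacter.sum_char_inv_mul_char_eq`
minus the principal term), with `ψ⁻¹(n) = conj ψ(n)` (`inv_apply_eq_conj`); hence the printed bounds
`≤ p − 1` on the diagonal and `≤ 1` off it (`norm_sum_ne_one_le`, `norm_sum_ne_one_le_one_of_ne`),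
the window remark that for `m, n < p` the congruence `m ≡ n` is `m = n`
(`natCast_eq_natCast_iff_of_lt`), and the same statements indexed by the campaign's family
`Skeleton.Chr D` (`Skeleton.sum_finsetOf_p_eq`, `…_char_mul_conj`, `norm_…_le`). Nothing here bears
on Theorems 1–2 of the source or on the cell's verdict.

## References

* Y. Zhang, arXiv:2211.02515v1 (2022), §2 p. 4 (the family `Ψ`); §15 p. 80; §17 p. 96.
  [cite: Zhang2022LandauSiegel, §15 p. 80 (proof of (15.4)); §17 p. 96]
-/

noncomputable section

open Complex

namespace Literature.NumberTheory.LFunctions.Zhang2022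

/-! ## The primitive characters to a prime modulus: orthogonality (`Z22:§15.u011`, §17 p. 96) -/

namespace PrimChar

/-- `ψ̄(a) = ψ⁻¹(a) = conj ψ(a)` for a Dirichlet character with values in `ℂ` (values are roots of
unity on units, `0` elsewhere). [cite: MontgomeryVaughan2007, §4.2] -/
theorem inv_apply_eq_conj {q : ℕ} (ψ : DirichletCharacter ℂ q) (a : ZMod q) :
    ψ⁻¹ a = (starRingEnd ℂ) (ψ a) := by
  rw [MulChar.inv_apply_eq_inv']
  by_cases ha : IsUnit a
  · exact Complex.inv_eq_conj (ψ.unit_norm_eq_one ha.unit)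
  · rw [MulChar.map_nonunit ψ ha, inv_zero, map_zero]

/-- The window remark behind "`≪ 1` if `n ≠ Dm`" [Z22 p. 80]: for natural numbers `m, n < q` the
congruence `m ≡ n (mod q)` is the equality `m = n` (at (15.4): `n < PT⁻⁵ < p`, `Dm < 2n < 2p`;
at §17: `m, n < D⁴ < p`). [cite: Zhang2022LandauSiegel, §15 p. 80 (proof of (15.4))] -/
theorem natCast_eq_natCast_iff_of_lt {q m n : ℕ} (hm : m < q) (hn : n < q) :
    (m : ZMod q) = (n : ZMod q) ↔ m = n := by
  rw [ZMod.natCast_eq_natCast_iff', Nat.mod_eq_of_lt hm, Nat.mod_eq_of_lt hn]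

section Prime

variable {p : ℕ} [Fact p.Prime]

/-- To a PRIME modulus `p`, a Dirichlet character is primitive iff it is non-principal
(its conductor divides `p`). So the manuscript's `Σ*_{ψ (mod p)}` over primitive `ψ` (§2 p. 4) is
the sum over `ψ ≠ 1`. [cite: MontgomeryVaughan2007, §9.1] [cite: Zhang2022LandauSiegel, §2 p. 4] -/
theorem isPrimitive_iff_ne_one (ψ : DirichletCharacter ℂ p) : ψ.IsPrimitive ↔ ψ ≠ 1 := by
  have hP : p.Prime := Fact.out
  haveI : NeZero p := ⟨hP.ne_zero⟩
  constructor
  · intro h h1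
    rw [h1, DirichletCharacter.isPrimitive_def, DirichletCharacter.conductor_one] at h
    exact hP.one_lt.ne h
  · intro h
    rw [DirichletCharacter.isPrimitive_def]
    rcases (Nat.dvd_prime hP).mp (DirichletCharacter.conductor_dvd_level ψ) with h1 | h2
    · exact absurd (DirichletCharacter.eq_one_iff_conductor_eq_one.mpr h1) h
    · exact h2

/-- **Orthogonality over ALL characters mod a prime `p`**: for `m, n ∈ ℤ/p`,
`Σ_ψ ψ(m)ψ⁻¹(n) = (p − 1)·[m = n ≠ 0]` (the orthogonality relations, Mathlib's
`DirichletCharacter.sum_char_inv_mul_char_eq`). [cite: MontgomeryVaughan2007, §4.2 Cor. 4.5] -/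
theorem sum_apply_mul_inv_apply (m n : ZMod p) :
    ∑ ψ : DirichletCharacter ℂ p, ψ m * ψ⁻¹ n
      = if m = n ∧ n ≠ 0 then ((p : ℂ) - 1) else 0 := by
  have hP : p.Prime := Fact.out
  haveI : NeZero p := ⟨hP.ne_zero⟩
  by_cases hn : n = 0
  · have : ∀ ψ : DirichletCharacter ℂ p, ψ m * ψ⁻¹ n = 0 := fun ψ => by
      rw [hn, MulChar.inv_apply', inv_zero, MulChar.map_nonunit ψ not_isUnit_zero, mul_zero]
    rw [if_neg (fun h => h.2 hn)]
    exact Finset.sum_eq_zero fun ψ _ => this ψ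
  · have hu : IsUnit n := isUnit_iff_ne_zero.mpr hn
    have key := DirichletCharacter.sum_char_inv_mul_char_eq ℂ hu m
    have e : ∀ ψ : DirichletCharacter ℂ p, ψ m * ψ⁻¹ n = ψ n⁻¹ * ψ m := fun ψ => by
      rw [MulChar.inv_apply', mul_comm]
    simp_rw [e, key, Nat.totient_prime hP]
    by_cases hmn : m = n
    · subst hmn; simp [hn, Nat.cast_sub hP.one_le]
    · simp [hmn, Ne.symm hmn]

/-- The principal character's term: `1(m)·1⁻¹(n) = [m ≠ 0][n ≠ 0]` mod a prime. [folklore] -/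
private theorem one_apply_mul_inv_one_apply (m n : ZMod p) :
    (1 : DirichletCharacter ℂ p) m * (1 : DirichletCharacter ℂ p)⁻¹ n
      = if m ≠ 0 ∧ n ≠ 0 then 1 else 0 := by
  have h1 : ∀ a : ZMod p, (1 : DirichletCharacter ℂ p) a = if a ≠ 0 then 1 else 0 := fun a => by
    by_cases ha : a = 0
    · rw [if_neg (not_not.mpr ha), ha]
      exact MulChar.map_nonunit (1 : DirichletCharacter ℂ p) (not_isUnit_zero (M₀ := ZMod p))
    · rw [if_pos ha, MulChar.one_apply (isUnit_iff_ne_zero.mpr ha)]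
  rw [inv_one, h1, h1]
  by_cases hm : m = 0 <;> by_cases hn : n = 0 <;> simp [hm, hn]

/-- **`Z22:§15.u011` [Z22 p. 80, tex L4045] and §17 p. 96 [tex L4723], EXACT form**: to a prime
modulus `p`, the sum over the PRIMITIVE (= non-principal, `isPrimitive_iff_ne_one`) characters
`Σ*_{ψ (mod p)} ψ(m)ψ̄(n) = (p − 1)·[m ≡ n ≢ 0] − [p ∤ mn]`.
[cite: Zhang2022LandauSiegel, §15 p. 80 (proof of (15.4)); §17 p. 96] -/
theorem sum_ne_one_apply_mul_inv_apply (m n : ZMod p) :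
    ∑ ψ ∈ (Finset.univ : Finset (DirichletCharacter ℂ p)).erase 1, ψ m * ψ⁻¹ n
      = (if m = n ∧ n ≠ 0 then ((p : ℂ) - 1) else 0) - (if m ≠ 0 ∧ n ≠ 0 then 1 else 0) := by
  rw [Finset.sum_erase_eq_sub (Finset.mem_univ _), sum_apply_mul_inv_apply,
    one_apply_mul_inv_one_apply]

/-- The printed bound on the DIAGONAL: `|Σ*_{ψ (mod p)} ψ(m)ψ̄(n)| ≤ p − 1 (≪ p)` for all `m, n`.
[cite: Zhang2022LandauSiegel, §15 p. 80 (`Z22:§15.u011`); §17 p. 96] -/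
theorem norm_sum_ne_one_le (m n : ZMod p) :
    ‖∑ ψ ∈ (Finset.univ : Finset (DirichletCharacter ℂ p)).erase 1, ψ m * ψ⁻¹ n‖
      ≤ (p : ℝ) - 1 := by
  have hP : p.Prime := Fact.out
  have h2 : (2 : ℝ) ≤ p := by exact_mod_cast hP.two_le
  rw [sum_ne_one_apply_mul_inv_apply]
  split_ifs
  · rw [show ((p : ℂ) - 1) - 1 = ((p - 2 : ℝ) : ℂ) by push_cast; ring, Complex.norm_real,
      Real.norm_of_nonneg (by linarith)]
    linarith
  · rw [sub_zero, show ((p : ℂ) - 1) = ((p - 1 : ℝ) : ℂ) by push_cast; ring, Complex.norm_real,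
      Real.norm_of_nonneg (by linarith)]
  · rw [zero_sub, norm_neg, norm_one]; linarith
  · rw [sub_zero, norm_zero]; linarith

/-- The printed bound OFF the diagonal: `|Σ*_{ψ (mod p)} ψ(m)ψ̄(n)| ≤ 1 (≪ 1)` if `m ≢ n (mod p)`.
[cite: Zhang2022LandauSiegel, §15 p. 80 (`Z22:§15.u011`); §17 p. 96] -/
theorem norm_sum_ne_one_le_one_of_ne {m n : ZMod p} (h : m ≠ n) :
    ‖∑ ψ ∈ (Finset.univ : Finset (DirichletCharacter ℂ p)).erase 1, ψ m * ψ⁻¹ n‖ ≤ 1 := by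
  rw [sum_ne_one_apply_mul_inv_apply, if_neg (fun hh => h hh.1), zero_sub, norm_neg]
  split_ifs
  · rw [norm_one]
  · rw [norm_zero]; exact zero_le_one

end Prime

end PrimChar

/-! ### The same sums indexed by the campaign's family `Ψ` (`Skeleton.Chr D`) -/

namespace Skeleton

/-- **Re-indexing `Σ*_{ψ (mod p)}` over the skeleton's family `Ψ`**: for a window prime `p ∼ P`,
the members `x : Chr D` with `x.p = p` are exactly the primitive = non-principal characters mod
`p`, so for any summand `F`,
`Σ_{x ∈ Ψ, p_x = p} F(p_x, ψ_x) = Σ_{ψ (mod p), ψ ≠ 1} F(p, ψ)`. [cite: Zhang2022LandauSiegel, §2 p. 4] -/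
theorem sum_finsetOf_p_eq {D : ℕ} {p : ℕ} [Fact p.Prime] (hp : p ∈ primeWindow D)
    (F : (q : ℕ) → DirichletCharacter ℂ q → ℂ) :
    ∑ x ∈ finsetOf {x : Chr D | x.p = p}, F x.p x.ψ
      = ∑ ψ ∈ (Finset.univ : Finset (DirichletCharacter ℂ p)).erase 1, F p ψ := by
  have hfin : ({x : Chr D | x.p = p} : Set (Chr D)).Finite := Set.toFinite _
  symm
  refine Finset.sum_bij (fun ψ hψ => (⟨p, hp, ψ,
      (PrimChar.isPrimitive_iff_ne_one ψ).mpr (Finset.mem_erase.mp hψ).1⟩ : Chr D))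
    (fun ψ hψ => ?_) (fun ψ₁ h₁ ψ₂ h₂ h => ?_) (fun x hx => ?_) (fun ψ hψ => rfl)
  · exact (mem_finsetOf hfin).mpr rfl
  · cases h; rfl
  · have hx' := mem_of_mem_finsetOf hx
    simp only [Set.mem_setOf_eq] at hx'
    obtain ⟨q, hq, ψ, hψ⟩ := x
    simp only at hx'
    subst hx'
    exact ⟨ψ, Finset.mem_erase.mpr ⟨(PrimChar.isPrimitive_iff_ne_one ψ).mp hψ, Finset.mem_univ _⟩,
      rfl⟩

/-- `Z22:§15.u011` / §17 p. 96 over `Ψ`: for a window prime `p` and `m, n : ℕ`,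
`Σ_{x ∈ Ψ, p_x = p} ψ_x(m) conj ψ_x(n) = (p−1)[m ≡ n ≢ 0 (p)] − [p ∤ m][p ∤ n]`.
[cite: Zhang2022LandauSiegel, §15 p. 80; §17 p. 96] -/
theorem sum_finsetOf_p_char_mul_conj {D : ℕ} {p : ℕ} (hp : p ∈ primeWindow D) (m n : ℕ) :
    ∑ x ∈ finsetOf {x : Chr D | x.p = p}, x.ψ (m : ZMod x.p) * (starRingEnd ℂ) (x.ψ (n : ZMod x.p))
      = (if (m : ZMod p) = n ∧ ¬ p ∣ n then ((p : ℂ) - 1) else 0)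
          - (if ¬ p ∣ m ∧ ¬ p ∣ n then 1 else 0) := by
  haveI : Fact p.Prime := ⟨(Finset.mem_filter.mp hp).2⟩
  rw [sum_finsetOf_p_eq hp (fun q ψ => ψ (m : ZMod q) * (starRingEnd ℂ) (ψ (n : ZMod q)))]
  simp_rw [← PrimChar.inv_apply_eq_conj]
  rw [PrimChar.sum_ne_one_apply_mul_inv_apply]
  simp only [ne_eq, ZMod.natCast_eq_zero_iff]

/-- The two printed bounds over `Ψ` [Z22 p. 80, `Z22:§15.u011`]: `≤ p − 1` always, and `≤ 1`
when `m ≢ n (mod p)`. [cite: Zhang2022LandauSiegel, §15 p. 80; §17 p. 96] -/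
theorem norm_sum_finsetOf_p_char_mul_conj_le {D : ℕ} {p : ℕ} (hp : p ∈ primeWindow D) (m n : ℕ) :
    ‖∑ x ∈ finsetOf {x : Chr D | x.p = p},
        x.ψ (m : ZMod x.p) * (starRingEnd ℂ) (x.ψ (n : ZMod x.p))‖ ≤ (p : ℝ) - 1 ∧
    ((m : ZMod p) ≠ n →
      ‖∑ x ∈ finsetOf {x : Chr D | x.p = p},
        x.ψ (m : ZMod x.p) * (starRingEnd ℂ) (x.ψ (n : ZMod x.p))‖ ≤ 1) := by
  haveI : Fact p.Prime := ⟨(Finset.mem_filter.mp hp).2⟩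
  rw [sum_finsetOf_p_eq hp (fun q ψ => ψ (m : ZMod q) * (starRingEnd ℂ) (ψ (n : ZMod q)))]
  simp_rw [← PrimChar.inv_apply_eq_conj]
  exact ⟨PrimChar.norm_sum_ne_one_le _ _, fun h => PrimChar.norm_sum_ne_one_le_one_of_ne h⟩

end Skeleton

end Literature.NumberTheory.LFunctions.Zhang2022
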